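import Literature.NumberTheory.NumberFields.ValuationCubeClassGroup
import Literature.NumberTheory.QuadraticFields.UnitsModCubes
import Literature.NumberTheory.NumberFields.UnramifiedCubicBaseChange
import Mathlib.GroupTheory.SpecificGroups.Cyclic.Basic
import HarnessLib

/-!
# Cube classes with valuations divisible by `3` in a real quadratic field with `3 ∤ h`

Topic `NumberTheory/QuadraticFields`.  Theorem-only file (no definition, no named fact).

The `r₃(k) = 0` case of the Selmer sequence used in Scholz's reflection theorem (Washington,
*Introduction to Cyclotomic Fields*, proof of Thm. 10.10): let `k` be a real quadratic field whose
class group has no element of order `3`, and `η ∈ 𝓞_kˣ` a unit which is not the cube of a unit.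
Then every `θ ∈ kˣ` all of whose valuations are divisible by `3` is of the form

  `θ = η^j · z³`, `j ∈ {0, 1, 2}`, `z ∈ kˣ`

(`exists_eq_unit_pow_mul_cube`).  Indeed `(θ) = 𝔟³` and `[𝔟] ∈ Cl(k)[3] = 1` give `θ ∈ 𝓞_kˣ·kˣ³`
(tree: `exists_subgroup_monoidHom_classGroup_of_dvd_valuation`, the map `W → Cl`, kernel
`𝓞ˣ·Kˣ³`), and `𝓞_kˣ/𝓞_kˣ³` has order `3` (tree: `Quadratic.natCard_units_mod_cubes_of_discr_pos`),
so it is generated by the class of `η`.  Consequently (`exists_cube_root_unit`), if such a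
`θ ∈ k` becomes a cube `w³` in an everywhere unramified cubic extension `L` of a quadratic
extension `M ⊇ k` (tree: `three_dvd_log_valuation_of_eq_cube` gives `3 ∣ v(θ)`) without being a
cube in `M`, then `j ≠ 0` and `η` itself has a cube root in `L` (`w/z` resp. `ηz/w`) — the step
"`L(∛β) = L(∛ε)`" of Washington's proof when `r₃(k) = 0`.

## References

* L. C. Washington, *Introduction to Cyclotomic Fields*, GTM 83, 2nd ed. (1997), proof of
  Thm. 10.10. [Washington1997]
* H. Cohen, *Advanced Topics in Computational Number Theory*, GTM 193 (2000), Prop. 5.2.5.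
  [Cohen2000]
-/

noncomputable section

open NumberField Module IsDedekindDomain WithZero

namespace Literature.NumberTheory.QuadraticFields

namespace ScholzHecke

open Literature.NumberTheory.NumberFields

/-- In a group of order `3`, every element is a power `g^j`, `j < 3`, of any `g ≠ 1`. [folklore] -/
theorem exists_pow_eq_of_card_eq_three {G : Type*} [Group G] (hG : Nat.card G = 3) {g : G}
    (hg : g ≠ 1) (x : G) : ∃ j : ℕ, j < 3 ∧ g ^ j = x := by
  haveI : Fact (Nat.Prime 3) := ⟨Nat.prime_three⟩
  have htop := zpowers_eq_top_of_prime_card hG hg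
  have hx : x ∈ Subgroup.zpowers g := by rw [htop]; exact Subgroup.mem_top x
  obtain ⟨m, hm⟩ := Subgroup.mem_zpowers_iff.mp hx
  refine ⟨(m % 3).toNat, ?_, ?_⟩
  · have := Int.emod_lt_of_pos m (by norm_num : (0:ℤ) < 3)
    have := Int.emod_nonneg m (by norm_num : (3:ℤ) ≠ 0)
    omega
  · rw [← hm, ← zpow_natCast, Int.toNat_of_nonneg (Int.emod_nonneg m (by norm_num))]
    have h3 : (3 : ℤ) = (Nat.card G : ℤ) := by rw [hG]; norm_num
    rw [h3, zpow_mod_natCard]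

/-- **Cube classes with valuations divisible by `3` when `3 ∤ h(k)`.**  Let `k` be a real quadratic
field (`[k:ℚ] = 2`, `d_k > 0`) whose class group has trivial `3`-torsion, `η ∈ 𝓞_kˣ` not the cube of
a unit, and `θ ∈ kˣ` with `3 ∣ v(θ)` for every finite place `v`.  Then `θ = η^j z³` with
`j ∈ {0,1,2}` and `z ∈ kˣ`. [cite: Washington1997, Thm 10.10 (proof)] -/
theorem exists_eq_unit_pow_mul_cube {k : Type*} [Field k] [NumberField k] (h2 : finrank ℚ k = 2)
    (hD : 0 < NumberField.discr k) (hcl : ∀ c : ClassGroup (𝓞 k), c ^ 3 = 1 → c = 1)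
    {η : (𝓞 k)ˣ} (hη : η ∉ Quadratic.unitCubes k) {θ : kˣ}
    (hθ : ∀ v : HeightOneSpectrum (𝓞 k), (3 : ℤ) ∣ log (v.valuation k θ)) :
    ∃ (j : ℕ) (z : kˣ), j < 3 ∧
      θ = (Units.map (algebraMap (𝓞 k) k : 𝓞 k →* k) η) ^ j * z ^ 3 := by
  classical
  obtain ⟨W, hW, φ, hφ3, hker⟩ :=
    exists_subgroup_monoidHom_classGroup_of_dvd_valuation (R := 𝓞 k) k (n := 3) three_ne_zero
  have hθW : θ ∈ W := (hW θ).mpr hθ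
  -- `φ θ = 1` since `Cl(k)[3] = 1`, so `θ = u z³` with `u` a unit
  obtain ⟨u, z, huz⟩ := (hker ⟨θ, hθW⟩).mp (hcl _ (hφ3 ⟨θ, hθW⟩))
  -- `u ≡ η^j` modulo cubes of units
  have h3 := Quadratic.natCard_units_mod_cubes_of_discr_pos h2 hD
  have hη1 : (QuotientGroup.mk η : (𝓞 k)ˣ ⧸ Quadratic.unitCubes k) ≠ 1 := by
    rwa [Ne, QuotientGroup.eq_one_iff]
  obtain ⟨j, hj, hju⟩ := exists_pow_eq_of_card_eq_three h3 hη1 (QuotientGroup.mk u)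
  rw [← QuotientGroup.mk_pow, QuotientGroup.eq] at hju
  obtain ⟨c, hc⟩ := hju
  -- `(η^j)⁻¹ * u = c³`, i.e. `u = η^j c³`
  have hu : u = η ^ j * c ^ 3 := by
    rw [powMonoidHom_apply] at hc
    rw [hc, mul_inv_cancel_left]
  refine ⟨j, Units.map (algebraMap (𝓞 k) k : 𝓞 k →* k) c * z, hj, ?_⟩
  have hθ' : θ = Units.map (algebraMap (𝓞 k) k : 𝓞 k →* k) u * z ^ 3 := huz
  rw [hθ', hu, map_mul, map_pow, map_pow, mul_pow, mul_assoc]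


/-- **If `θ ∈ k` (as above) is a cube in an unramified cubic extension `L` of a quadratic
`M ⊇ k` but not in `M`, then the unit `η` has a cube root in `L`.**  (`3 ∣ v(θ)` for all `v` by
the tree's `three_dvd_log_valuation_of_eq_cube`, so `θ = ηʲ z³` with `j ≠ 0`.)
[cite: Washington1997, Thm 10.10 (proof)] -/
theorem exists_cube_root_unit {k M L : Type*} [Field k] [NumberField k] [Field M] [NumberField M]
    [Field L] [NumberField L] [Algebra k M] [Algebra M L] [Algebra k L] [IsScalarTower k M L]
    (h2 : finrank ℚ k = 2) (hD : 0 < NumberField.discr k)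
    (hcl : ∀ c : ClassGroup (𝓞 k), c ^ 3 = 1 → c = 1) (hkM : finrank k M ≤ 2)
    (hunr : ∀ (P : Ideal (𝓞 L)) [P.IsMaximal], P ≠ ⊥ → P.ramificationIdx (𝓞 M) = 1)
    {η : (𝓞 k)ˣ} (hη : η ∉ Quadratic.unitCubes k) {x : k} {w : L}
    (hw : w ^ 3 = algebraMap k L x) (hx : ∀ e : M, e ^ 3 ≠ algebraMap k M x) :
    ∃ y₀ : L, y₀ ^ 3 = algebraMap k L ((η : 𝓞 k) : k) := by
  classical
  have hx0 : x ≠ 0 := by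
    rintro rfl
    exact hx 0 (by rw [map_zero]; ring)
  have hw0 : w ≠ 0 := by
    intro h
    rw [h, zero_pow three_ne_zero, eq_comm, map_eq_zero] at hw
    exact hx0 hw
  set θ : kˣ := Units.mk0 x hx0 with hθ
  have hval : ∀ v : HeightOneSpectrum (𝓞 k), (3 : ℤ) ∣ log (v.valuation k (θ : k)) := fun v =>
    three_dvd_log_valuation_of_eq_cube hkM (fun P _ hP => hunr P hP) (x := (θ : k)) (y := w)
      (by rw [hθ, Units.val_mk0, hw]) v
  obtain ⟨j, z, hj, hθeq⟩ := exists_eq_unit_pow_mul_cube h2 hD hcl hη hval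
  have hxeq : x = ((η : 𝓞 k) : k) ^ j * (z : k) ^ 3 := by
    have := congrArg Units.val hθeq
    rw [hθ, Units.val_mk0] at this
    rw [this]
    simp [Units.val_pow_eq_pow_val]
  have hz0 : (z : k) ≠ 0 := z.ne_zero
  set ηL : L := algebraMap k L ((η : 𝓞 k) : k) with hηL
  set zL : L := algebraMap k L (z : k) with hzL
  have hzL0 : zL ≠ 0 := by rw [hzL, map_ne_zero]; exact hz0
  have hwL : w ^ 3 = ηL ^ j * zL ^ 3 := by rw [hw, hxeq, map_mul, map_pow, map_pow]
  interval_cases j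
  · exfalso
    apply hx (algebraMap k M (z : k))
    rw [hxeq, pow_zero, one_mul, map_pow]
  · refine ⟨w / zL, ?_⟩
    rw [div_pow, hwL, pow_one, mul_div_cancel_right₀ _ (pow_ne_zero 3 hzL0)]
  · refine ⟨ηL * zL / w, ?_⟩
    have hηL0 : ηL ≠ 0 := by
      rw [hηL, map_ne_zero, ne_eq, RingOfIntegers.coe_eq_zero_iff]
      exact Units.ne_zero η
    rw [div_pow, mul_pow, hwL]
    field_simp

end ScholzHecke

end Literature.NumberTheory.QuadraticFields

end
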